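import Summits.CriticalPhenomena.PercolationContinuityZ3.Theorems.Transplant.KNLevelsHGluing
import Summits.CriticalPhenomena.PercolationContinuityZ3.Theorems.Transplant.KNLevelsTargetLemmaKN
import Summits.CriticalPhenomena.PercolationContinuityZ3.Theorems.Transplant.ProdBoxes
import Literature.Probability.Percolation.SiteBondCriticalPoints
import Literature.Barriers.CriticalPhenomena.SubexponentialGrowthZdProofs
import HarnessLib

/-!
# The target property over levels holds UNCONDITIONALLY (Conjecture 3 = the tree theorem `CSH.kozmaNitzan_conjecture3_holds`) on every
# countable graph of bounded degree at every `p < 1`; instances `X □ ℤ²` (`Δ_X + 4`), quasi-transitive graphs, and `ℤ^d` (`2d`)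

builds on p205010 (kernel theorem, internal audit signed; external expert review pending): the gluing input is discharged by
`CSH.kozmaNitzan_conjecture3_holds` through p2-g2's `KNLevels.gluing_of_conjecture3` (`KNLevelsTargetLemmaKN.lean`).
Lane `prim-bschramm`, seat `prim-bschramm-stmt` (F7 sequel; keeps `KNLevelsHGluing.lean` itself light, as the lead/p2-g2 asked).

* `KNLevels.avoidingGluing_KN` — the avoiding gluing schema on every countable vertex type, unconditionally;
* **`KNLevels.targetProperty_KN (hΔ) (p) (hp1) : TargetProperty G Δ p`** — the target property at every `p < 1` on every countable locally finite
  graph of degree `≤ Δ` (the per-level seed/cube kits remain the instance's obligation: they are the hypothesis inside `TargetProperty`);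
* `KNLevels.targetProperty_of_isQuasiTransitive_KN` — on a connected quasi-transitive locally finite graph (bounded degree by
  `IsQuasiTransitive.exists_degree_le`) there is `Δ` with `TargetProperty G Δ p` for all `p < 1`;
* `KNLevels.targetProperty_boxProdZ2_KN` — `X □ ℤ²` with `deg X ≤ Δ`: `TargetProperty (X □ zdGraph 2) (Δ + 4) p` (p2's `ProdKN.degree_prod_le`);
* `KNLevels.targetProperty_zdGraph_KN` — `ℤ^d`: `TargetProperty (zdGraph d) (2d) p` (tree `degree_zdGraph_le_two_mul`).
[cite: KozmaNitzan2024, §4 Lemma 10 (p. 17) with Conjecture 3 (p. 15)]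
-/

noncomputable section

open MeasureTheory ProbabilityTheory

namespace Summit.CriticalPhenomena.PercolationContinuityZ3.Theorems

namespace Transplant

namespace KNLevels

open Literature.Probability.Percolation Literature.Probability.LatticeModels SimpleGraph
open Literature.Barriers.CriticalPhenomena (IsQuasiTransitive)

/-- **The avoiding gluing schema holds on every countable vertex type** (Conjecture 3 is a theorem of the tree; builds on p205010 (kernel theorem,
internal audit signed; external expert review pending)). [cite: KozmaNitzan2024, Conjecture 3 (p. 15)] -/
theorem avoidingGluing_KN {V : Type} [DecidableEq V] [Countable V] : AvoidingGluing V :=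
  fun ε hε => avoidingGluing_of_gluing (V := V) gluing_of_conjecture3 ε hε

/-- **The target property over levels, unconditionally**, for every countable locally finite graph of degree `≤ Δ` and every `p < 1` — builds on
p205010 (kernel theorem, internal audit signed; external expert review pending). [cite: KozmaNitzan2024, §4 Lemma 10 (pp. 17–22)] -/
theorem targetProperty_KN {V : Type} [DecidableEq V] [Countable V] {G : SimpleGraph V} [G.LocallyFinite] {Δ : ℕ}
    (hΔ : ∀ x, G.degree x ≤ Δ) (p : unitInterval) (hp1 : (p : ℝ) < 1) : TargetProperty G Δ p :=
  targetProperty_of_avoidingGluing hΔ avoidingGluing_KN p hp1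

/-- **Quasi-transitive graphs**: a connected, locally finite, quasi-transitive graph has bounded degree, hence the target property at every
`p < 1` for some `Δ` (countability from connectedness). [cite: KozmaNitzan2024, §4 Lemma 10 (p. 17)] -/
theorem targetProperty_of_isQuasiTransitive_KN {V : Type} [DecidableEq V] {G : SimpleGraph V} [G.LocallyFinite] (hc : G.Connected)
    (hq : IsQuasiTransitive G) (p : unitInterval) (hp1 : (p : ℝ) < 1) : ∃ Δ : ℕ, (∀ x, G.degree x ≤ Δ) ∧ TargetProperty G Δ p := by
  obtain ⟨x⟩ := hc.nonempty
  haveI : Countable V := Literature.Barriers.CriticalPhenomena.countable_of_connected_of_locallyFinite G hc x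
  obtain ⟨Δ, hΔ⟩ := hq.exists_degree_le
  exact ⟨Δ, hΔ, targetProperty_KN hΔ p hp1⟩

/-- **Products `X □ ℤ²`**: if `deg X ≤ Δ` then `TargetProperty (X □ ℤ²) (Δ + 4) p` for every `p < 1` (degree bound p2's `ProdKN.degree_prod_le`).
[cite: KozmaNitzan2024, §4 Lemma 10 (p. 17)] -/
theorem targetProperty_boxProdZ2_KN {W : Type} [DecidableEq W] [Countable W] (X : SimpleGraph W) [X.LocallyFinite] {Δ : ℕ}
    (hΔ : ∀ w, X.degree w ≤ Δ) (p : unitInterval) (hp1 : (p : ℝ) < 1) : TargetProperty (X □ zdGraph 2) (Δ + 4) p :=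
  targetProperty_KN (ProdKN.degree_prod_le X hΔ) p hp1

/-- **`ℤ^d`**: `TargetProperty (zdGraph d) (2d) p` for every `p < 1` (the levels form of KN's Lemma 10 on its own lattice; degree `2d`).
[cite: KozmaNitzan2024, §4 Lemma 10 (p. 17)] -/
theorem targetProperty_zdGraph_KN (d : ℕ) (p : unitInterval) (hp1 : (p : ℝ) < 1) : TargetProperty (zdGraph d) (2 * d) p :=
  targetProperty_KN degree_zdGraph_le_two_mul p hp1

end KNLevels

end Transplant

end Summit.CriticalPhenomena.PercolationContinuityZ3.Theorems
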